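import Literature.Probability.LatticeModels.IntersectionPropertyCore
import Literature.Probability.LatticeModels.IntersectionPropertyLatticePrelim
import Literature.Probability.LatticeModels.TwoPointSphereSums
import Literature.Probability.LatticeModels.IntermediaryScales
import HarnessLib

/-!
# The intersection property in finite volume on `ℤ⁴` (Aizenman–Duminil-Copin 2021, Lemma 6.2)

Topic `Literature/Probability/LatticeModels`. Theorems only (no definition, no named fact).

M. Aizenman, H. Duminil-Copin, *Marginal triviality of the scaling limits of critical 4D Ising and
`φ⁴₄` models*, Ann. of Math. **194** (2021), arXiv:1912.07973 [AizenmanDuminilCopinAnnals2021],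
**Lemma 6.2** (p. 21): "Fix `d = 4`. There exists `c > 0` such that for every `β ≤ β_c`, every `k`,
and every `y ∉ Λ_{2ℓ_{k+1}}` in a regular scale, `P^{0y,0y,∅,∅}_β[I_k] ≥ c`." Proof (p. 21):
"Restricting our attention to the case of `y` belonging to a regular scale enables us to use
properties P1 and P2 of the regularity assumption on the scale. With this additional assumption, we
follow the same proof as the one of the conditional version (Lemma 4.4). Introduce the intermediary
integers `n ≤ m ≤ M ≤ N` … For the second moment method on `𝓜`, the first and second moments take
the following forms `E[|𝓜|] ≥ c₁(B_M(β) - B_{m-1}(β)) ≥ c₂ B_{ℓ_{k+1}}(β)`,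
`E[|𝓜|²] ≤ c₃ (B_M(β) - B_{m-1}(β)) B_{2M}(β) ≤ c₃ B_{ℓ_{k+1}}(β)²` where … we used that `D` is large
enough and Lemma 6.3 … For the bound on the probabilities of the events `F₁,…,F₄` … the bounds in
(4.7) and (4.8) follow readily from the Infrared Bound (5.1)."

This file carries this out in finite volume (free boundary condition on the boxes `Λ_L`, `L → ∞`,
App. A.2) and proves `intersectionProperty_Hint`, the hypothesis `Hint` of
`improvedTreeDiagramBound_of_intersection_and_mixing` (`IntersectionClusteringBound.lean`) verbatim:
for regularity constants `c₀, C₀` there are `α₀, D₁, c_I > 0` such that for `0 < β ≤ β_c`, scales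
`2 ≤ a`, `a^{α₀} ≤ b` in the window `b ≤ ξ(β)` with `D₁ B_a ≤ B_b`, a centre `u` and a far vertex `y`
central in a `(c₀,C₀)`-regular scale with `‖y-u‖ > 2b`, eventually in `L`,
`c_I · finVolFourNrm (box 4 L) β u y y ≤ finVolIkMass (box 4 L) β u y a b`.

Ingredients (all in the tree): the finite-graph assembly `Current.ikMass_lower_bound_of_twoPoint`
(`IntersectionPropertyCore.lean`: second moment, `{𝓜 ≠ ∅} ⊆ I_k ∪ ⋃ Fᵢ`, bounds on `Fᵢ`); the
intermediary scales (`IntermediaryScales.lean`); the infrared bound and Lemma 6.3 for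
`twoPointFree 4 β`, the box ↔ lattice dictionary and the regular annulus about a central vertex
(`IntersectionPropertyLatticePrelim.lean`); the sphere and annulus sums (`TwoPointSphereSums.lean`);
the comparison of box and infinite-volume two-point functions (`BoxTwoPointTransfer.lean`).

## References

* M. Aizenman, H. Duminil-Copin, Ann. of Math. 194 (2021), arXiv:1912.07973, §6.1, Lemma 6.2 and its
  proof (p. 21); §4.2, proof of Lemma 4.4 (pp. 11–12); Def. 5.11 (p. 20); Lemma 6.3 (p. 21)
  [AizenmanDuminilCopinAnnals2021].
-/

noncomputable section

open Finset Filter Topology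
open scoped symmDiff ENNReal

namespace Literature.Probability.LatticeModels

/-! ### Part A. Arithmetic of the scales and of the constants -/

/-- From `a^{α₀} ≤ b` with `α₀ = 81 + 40T` and `a ≥ 2` to the hypothesis `T^40 a^81 ≤ b` of
`exists_intermediaryScales`. [folklore] -/
theorem scales_hyp_of_rpow_le {T a b : ℕ} (ha : 2 ≤ a) (h : (a : ℝ) ^ (((81 + 40 * T : ℕ)) : ℝ) ≤ b) :
    T ^ 40 * a ^ 81 ≤ b := by
  rw [Real.rpow_natCast] at h
  have hT2 : (T : ℝ) ≤ 2 ^ T := by exact_mod_cast Nat.lt_two_pow_self.le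
  have ha2 : (2 : ℝ) ≤ a := by exact_mod_cast ha
  have key : (T : ℝ) ^ 40 * (a : ℝ) ^ 81 ≤ (a : ℝ) ^ (81 + 40 * T) :=
    calc (T : ℝ) ^ 40 * (a : ℝ) ^ 81 ≤ ((2 : ℝ) ^ T) ^ 40 * (a : ℝ) ^ 81 := by gcongr
      _ ≤ ((a : ℝ) ^ T) ^ 40 * (a : ℝ) ^ 81 := by gcongr
      _ = (a : ℝ) ^ (81 + 40 * T) := by rw [← pow_mul, ← pow_add]; congr 1; ring
  exact_mod_cast key.trans h

/-- `log(T⁴ a⁸)/log a ≤ (4 log T)/log 2 + 8` for `T ≥ 1`, `a ≥ 2`. [folklore] -/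
theorem log_T4a8_div_log_le {T a : ℕ} (hT : 1 ≤ T) (ha : 2 ≤ a) :
    Real.log ((T : ℝ) ^ 4 * (a : ℝ) ^ 8) / Real.log a ≤ 4 * Real.log T / Real.log 2 + 8 := by
  have hT' : (1 : ℝ) ≤ T := by exact_mod_cast hT
  have ha' : (2 : ℝ) ≤ a := by exact_mod_cast ha
  have hlog2 : 0 < Real.log 2 := Real.log_pos one_lt_two
  have hloga : Real.log 2 ≤ Real.log a := Real.log_le_log two_pos ha'
  have hloga0 : 0 < Real.log a := hlog2.trans_le hloga
  have hlogT : 0 ≤ Real.log T := Real.log_nonneg hT'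
  rw [Real.log_mul (by positivity) (by positivity), Real.log_pow, Real.log_pow, add_div]
  have h1 : (4 : ℕ) * Real.log T / Real.log a ≤ 4 * Real.log T / Real.log 2 := by
    push_cast
    exact div_le_div_of_nonneg_left (by positivity) hlog2 hloga
  have h2 : (8 : ℕ) * Real.log a / Real.log a = 8 := by
    push_cast; field_simp
  linarith [h1, h2.le, h2.ge]

/-! ### Part B. The bubble diagrams between the scales (Lemma 6.3 and `D₁ B_a ≤ B_b`) -/

/-- **Upper comparison** `B_b ≤ (1 + 11C) B_{M₀}` for `512 ≤ M₀ ≤ b ≤ M₀^{11}` in the window, from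
Lemma 6.3 in the tree's form `B_L ≤ (1 + C(1 + log(L/ℓ))/log ℓ) B_ℓ`
("`B_M(β) ≥ B_{ℓ_{k+1}}(β)/(1+15C)`", p. 21). [cite: AizenmanDuminilCopinAnnals2021, arXiv:1912.07973 §6.1, proof of Lemma 6.2, display after (6.3) (p. 21)] -/
theorem bubble_upper_of_growth {C : ℝ} (hC : 0 < C) {β : ℝ}
    (hgrowth : ∀ ℓ L : ℕ, 2 ≤ ℓ → ℓ ≤ L →
      (β = criticalBeta 4 ∨ (0 < β ∧ (L : ℝ) * invCorrLength (twoPointPlus 4 β) ≤ 1)) →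
      bubbleDiagram (twoPointFree 4 β) L ≤
        (1 + C * (1 + Real.log ((L : ℝ) / ℓ)) / Real.log ℓ) * bubbleDiagram (twoPointFree 4 β) ℓ)
    {M₀ b : ℕ} (hM : 512 ≤ M₀) (hMb : M₀ ≤ b) (hbM : b ≤ M₀ ^ 11)
    (hwin : β = criticalBeta 4 ∨ (0 < β ∧ (b : ℝ) * invCorrLength (twoPointPlus 4 β) ≤ 1)) :
    bubbleDiagram (twoPointFree 4 β) b ≤ (1 + 11 * C) * bubbleDiagram (twoPointFree 4 β) M₀ := by
  have h := hgrowth M₀ b (by omega) hMb hwin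
  refine h.trans (mul_le_mul_of_nonneg_right ?_ (bubbleDiagram_nonneg _ _))
  have hM' : (512 : ℝ) ≤ M₀ := by exact_mod_cast hM
  have hM0 : (0 : ℝ) < M₀ := by linarith
  have hb0 : (0 : ℝ) < b := by exact_mod_cast (show 0 < b by omega)
  have hlogM : 1 ≤ Real.log (M₀ : ℝ) := by
    rw [← Real.log_exp 1]
    refine Real.log_le_log (Real.exp_pos 1) (le_trans ?_ hM')
    have := Real.exp_one_lt_d9
    norm_num at this ⊢
    linarith
  have hlogM0 : 0 < Real.log (M₀ : ℝ) := by linarith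
  have hlogb : Real.log (b : ℝ) ≤ 11 * Real.log M₀ := by
    have h1 : Real.log (b : ℝ) ≤ Real.log ((M₀ : ℝ) ^ 11) := Real.log_le_log hb0 (by exact_mod_cast hbM)
    have h2 : Real.log ((M₀ : ℝ) ^ 11) = 11 * Real.log M₀ := by
      rw [Real.log_pow]; push_cast; ring
    linarith
  have hratio : Real.log ((b : ℝ) / M₀) ≤ 10 * Real.log M₀ := by
    rw [Real.log_div hb0.ne' hM0.ne']
    linarith
  have hfrac : (1 + Real.log ((b : ℝ) / M₀)) / Real.log M₀ ≤ 11 := by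
    rw [div_le_iff₀ hlogM0]
    nlinarith
  rw [mul_div_assoc]
  linarith [mul_le_mul_of_nonneg_left hfrac hC.le]

/-- **Lower comparison** `B_{m₀-1} ≤ (1 + C((4 log T)/log 2 + 10)) B_a` for `2 ≤ a < m₀ = T⁴a⁹`,
`m₀ - 1` in the window ("`B_{m-1}(β) ≤ (1+15C)B_{ℓ_k}(β)`", p. 21). [cite: AizenmanDuminilCopinAnnals2021, arXiv:1912.07973 §6.1, proof of Lemma 6.2, display after (6.3) (p. 21)] -/
theorem bubble_lower_of_growth {C : ℝ} (hC : 0 < C) {β : ℝ}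
    (hgrowth : ∀ ℓ L : ℕ, 2 ≤ ℓ → ℓ ≤ L →
      (β = criticalBeta 4 ∨ (0 < β ∧ (L : ℝ) * invCorrLength (twoPointPlus 4 β) ≤ 1)) →
      bubbleDiagram (twoPointFree 4 β) L ≤
        (1 + C * (1 + Real.log ((L : ℝ) / ℓ)) / Real.log ℓ) * bubbleDiagram (twoPointFree 4 β) ℓ)
    {T a m₀ : ℕ} (hT : 1 ≤ T) (ha : 2 ≤ a) (hm₀ : m₀ = T ^ 4 * a ^ 9) (ham : a < m₀)
    (hwin : β = criticalBeta 4 ∨ (0 < β ∧ ((m₀ - 1 : ℕ) : ℝ) * invCorrLength (twoPointPlus 4 β) ≤ 1)) :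
    bubbleDiagram (twoPointFree 4 β) ((m₀ - 1 : ℕ) : ℝ) ≤
      (1 + C * (4 * Real.log T / Real.log 2 + 10)) * bubbleDiagram (twoPointFree 4 β) a := by
  have h := hgrowth a (m₀ - 1) ha (by omega) hwin
  refine h.trans (mul_le_mul_of_nonneg_right ?_ (bubbleDiagram_nonneg _ _))
  have ha' : (2 : ℝ) ≤ a := by exact_mod_cast ha
  have ha0 : (0 : ℝ) < a := by linarith
  have hT' : (1 : ℝ) ≤ T := by exact_mod_cast hT
  have hlog2 : 0 < Real.log 2 := Real.log_pos one_lt_two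
  have hloga : Real.log 2 ≤ Real.log a := Real.log_le_log two_pos ha'
  have hloga0 : 0 < Real.log a := hlog2.trans_le hloga
  have hm1 : ((m₀ - 1 : ℕ) : ℝ) ≤ (T : ℝ) ^ 4 * (a : ℝ) ^ 9 := by
    have : m₀ - 1 ≤ T ^ 4 * a ^ 9 := by omega
    exact_mod_cast this
  have hm1pos : (0 : ℝ) < ((m₀ - 1 : ℕ) : ℝ) := by
    have : 0 < m₀ - 1 := by omega
    exact_mod_cast this
  -- `log((m₀-1)/a) ≤ log(T⁴ a⁸)`
  have hratio : Real.log (((m₀ - 1 : ℕ) : ℝ) / a) ≤ Real.log ((T : ℝ) ^ 4 * (a : ℝ) ^ 8) := by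
    refine Real.log_le_log (div_pos hm1pos ha0) ?_
    rw [div_le_iff₀ ha0]
    calc (((m₀ - 1 : ℕ) : ℝ)) ≤ (T : ℝ) ^ 4 * (a : ℝ) ^ 9 := hm1
      _ = (T : ℝ) ^ 4 * (a : ℝ) ^ 8 * a := by ring
  have hfrac : (1 + Real.log (((m₀ - 1 : ℕ) : ℝ) / a)) / Real.log a ≤ 4 * Real.log T / Real.log 2 + 10 := by
    have h1 : (1 + Real.log (((m₀ - 1 : ℕ) : ℝ) / a)) / Real.log a ≤
        1 / Real.log a + Real.log ((T : ℝ) ^ 4 * (a : ℝ) ^ 8) / Real.log a := by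
      rw [← add_div]
      exact div_le_div_of_nonneg_right (by linarith) hloga0.le
    have h2 : 1 / Real.log a ≤ 2 := by
      rw [div_le_iff₀ hloga0]
      have := Real.log_two_gt_d9
      linarith
    have h3 := log_T4a8_div_log_le hT ha
    linarith
  rw [mul_div_assoc]
  linarith [mul_le_mul_of_nonneg_left hfrac hC.le]


/-! ### Part C. The two-point estimates (real inequalities on finite index sets) -/

/-- **First moment, lower bound** ("`E[|𝓜|] ≥ c₁(B_M − B_{m-1})`"): if on `A` the far factor is
comparable to `S(y-u)` (`S(y-u) ≤ C S_y(v)`, regularity P1) and the box two-point functions are at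
least half of the infinite-volume ones, then `S(y-u)²/(16C²) ∑_A S_u(v)² ≤ ∑_A (g_y(v) g_u(v))²`.
[cite: AizenmanDuminilCopinAnnals2021, arXiv:1912.07973 §6.1, proof of Lemma 6.2, display (6.4) first line (p. 21)] -/
theorem first_moment_lower {ι : Type*} (A : Finset ι) {gy gu Sy Su : ι → ℝ} {C Suy : ℝ} (hC : 0 < C)
    (hSuy : 0 ≤ Suy) (hSu : ∀ v ∈ A, 0 ≤ Su v) (h1 : ∀ v ∈ A, Suy ≤ C * Sy v)
    (h2 : ∀ v ∈ A, Sy v / 2 ≤ gy v) (h3 : ∀ v ∈ A, Su v / 2 ≤ gu v) :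
    Suy ^ 2 / (16 * C ^ 2) * ∑ v ∈ A, Su v ^ 2 ≤ ∑ v ∈ A, (gy v * gu v) ^ 2 := by
  rw [Finset.mul_sum]
  refine Finset.sum_le_sum fun v hv => ?_
  have ha : Suy / (2 * C) ≤ gy v := by
    rw [div_le_iff₀ (by positivity)]
    have := h2 v hv
    have := h1 v hv
    nlinarith
  have hb : Su v / 2 ≤ gu v := h3 v hv
  have ha0 : 0 ≤ Suy / (2 * C) := by positivity
  have hb0 : 0 ≤ Su v / 2 := by linarith [hSu v hv]
  calc Suy ^ 2 / (16 * C ^ 2) * Su v ^ 2 = (Suy / (2 * C) * (Su v / 2)) ^ 2 := by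
        field_simp
        ring
    _ ≤ (gy v * gu v) ^ 2 := pow_le_pow_left₀ (mul_nonneg ha0 hb0) (mul_le_mul ha hb hb0 (ha0.trans ha)) 2

/-- **Second moment, upper bound** ("`E[|𝓜|²] ≤ c₃(B_M − B_{m-1}) B_{2M}`", the two-point part):
with `g ≤ S` pointwise and the far factors `S(w,y) ≤ C S(y-u)` on `A` (regularity P1),
`∑_{A×A} (g_uv g_vw g_wy + g_uw g_wv g_vy)² ≤ C² S(y-u)² ∑_{A×A} (S_uv S_vw + S_uw S_wv)²`.
[cite: AizenmanDuminilCopinAnnals2021, arXiv:1912.07973 §6.1, proof of Lemma 6.2, display (6.4) second line (p. 21)] -/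
theorem second_moment_upper {ι : Type*} (A : Finset ι) (g S : ι → ι → ℝ) (u y : ι) {C Suy : ℝ}
    (hg0 : ∀ v w, 0 ≤ g v w) (hgS : ∀ v w, g v w ≤ S v w) (hS0 : ∀ v w, 0 ≤ S v w)
    (hreg : ∀ w ∈ A, S w y ≤ C * Suy) :
    ∑ v ∈ A, ∑ w ∈ A, (g u v * g v w * g w y + g u w * g w v * g v y) ^ 2 ≤
      C ^ 2 * Suy ^ 2 * ∑ v ∈ A, ∑ w ∈ A, (S u v * S v w + S u w * S w v) ^ 2 := by
  rw [Finset.mul_sum]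
  refine Finset.sum_le_sum fun v hv => ?_
  rw [Finset.mul_sum]
  refine Finset.sum_le_sum fun w hw => ?_
  have h1 : g u v * g v w * g w y ≤ S u v * S v w * (C * Suy) :=
    mul_le_mul (mul_le_mul (hgS u v) (hgS v w) (hg0 v w) (hS0 u v)) ((hgS w y).trans (hreg w hw))
      (hg0 w y) (mul_nonneg (hS0 u v) (hS0 v w))
  have h2 : g u w * g w v * g v y ≤ S u w * S w v * (C * Suy) :=
    mul_le_mul (mul_le_mul (hgS u w) (hgS w v) (hg0 w v) (hS0 u w)) ((hgS v y).trans (hreg v hv))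
      (hg0 v y) (mul_nonneg (hS0 u w) (hS0 w v))
  have h0 : 0 ≤ g u v * g v w * g w y + g u w * g w v * g v y :=
    add_nonneg (mul_nonneg (mul_nonneg (hg0 _ _) (hg0 _ _)) (hg0 _ _))
      (mul_nonneg (mul_nonneg (hg0 _ _) (hg0 _ _)) (hg0 _ _))
  calc (g u v * g v w * g w y + g u w * g w v * g v y) ^ 2
      ≤ (S u v * S v w * (C * Suy) + S u w * S w v * (C * Suy)) ^ 2 :=
        pow_le_pow_left₀ h0 (add_le_add h1 h2) 2
    _ = C ^ 2 * Suy ^ 2 * (S u v * S v w + S u w * S w v) ^ 2 := by ring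

/-- **The zigzag sums** (bounds on `F₁`, `F₄`, two-point part): with `g ≤ S` and the far factor
`S(w,y) ≤ C S(y-u)` on `S'`, `∑_{S_×S'} g_uv g_vw g_wy ≤ C S(y-u) ∑_{S×S'} S_uv S_vw`.
[cite: AizenmanDuminilCopinAnnals2021, arXiv:1912.07973 §4.2, proof of Lemma 4.4, display (4.7) (p. 12); §6.1, proof of Lemma 6.2 (p. 21)] -/
theorem zigzag_sum_upper {ι : Type*} (Sv Sw : Finset ι) (g S : ι → ι → ℝ) (u y : ι) {C Suy : ℝ}
    (hg0 : ∀ v w, 0 ≤ g v w) (hgS : ∀ v w, g v w ≤ S v w) (hS0 : ∀ v w, 0 ≤ S v w)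
    (hreg : ∀ w ∈ Sw, S w y ≤ C * Suy) :
    ∑ v ∈ Sv, ∑ w ∈ Sw, g u v * g v w * g w y ≤ C * Suy * ∑ v ∈ Sv, ∑ w ∈ Sw, S u v * S v w := by
  rw [Finset.mul_sum]
  refine Finset.sum_le_sum fun v _ => ?_
  rw [Finset.mul_sum]
  refine Finset.sum_le_sum fun w hw => ?_
  calc g u v * g v w * g w y ≤ S u v * S v w * (C * Suy) :=
        mul_le_mul (mul_le_mul (hgS u v) (hgS v w) (hg0 v w) (hS0 u v)) ((hgS w y).trans (hreg w hw))
          (hg0 w y) (mul_nonneg (hS0 u v) (hS0 v w))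
    _ = C * Suy * (S u v * S v w) := by ring

/-- **The band sums** (bounds on `F₂`, `F₃`, two-point part): `∑ g_vw² ≤ ∑ S_vw²` for `0 ≤ g ≤ S`.
[cite: AizenmanDuminilCopinAnnals2021, arXiv:1912.07973 §4.2, proof of Lemma 4.4, display (4.8) (p. 12)] -/
theorem band_sum_upper {ι : Type*} (Sv Sw : Finset ι) (g S : ι → ι → ℝ)
    (hg0 : ∀ v w, 0 ≤ g v w) (hgS : ∀ v w, g v w ≤ S v w) :
    ∑ v ∈ Sv, ∑ w ∈ Sw, g v w ^ 2 ≤ ∑ v ∈ Sv, ∑ w ∈ Sw, S v w ^ 2 :=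
  Finset.sum_le_sum fun v _ => Finset.sum_le_sum fun w _ => pow_le_pow_left₀ (hg0 v w) (hgS v w) 2


/-! ### Part D. The intersection property in a box -/

/-- Geometry of the distance on a box of `ℤ⁴`: `dist u v = ‖v - u‖_∞`. [folklore] -/
theorem dist_eq_supNorm_sub' (u v : Site 4) : dist u v = (Site.supNorm (v - u) : ℝ) := by
  rw [Site.dist_eq_supNorm, Site.supNorm_sub_comm]

set_option maxHeartbeats 1000000 in
open Classical in
/-- **Aizenman–Duminil-Copin 2021, Lemma 6.2, in one box `Λ_L`.** For `0 < β ≤ β_c`, the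
infrared constant `A`, a regularity constant `C₀`, the margin `T ≥ 216²A²(32C₀+64)/c` and scales
`a < n₀ = Ta³ ≤ m₀ = T⁴a⁹ ≤ M₀ ≤ N₀ < b` as produced by `exists_intermediaryScales`, the bubble
inequality `2048 c C₀⁶ B_{2M₀} ≤ B_{M₀} - B_{m₀-1}` (the first/second moment comparison), a vertex
`y` central in a `C₀`-regular scale `n` with `‖y-u‖ > 2b`, and a box `Λ_L` containing `u`, `y`, the
ball `u + Λ_{M₀}`, on which the relevant box two-point functions are at least half the
infinite-volume ones: `c · finVolFourNrm Λ_L ≤ finVolIkMass Λ_L`, i.e. `P^{uy,uy,∅,∅}_{Λ_L}[I(a,b)] ≥ c`.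
[cite: AizenmanDuminilCopinAnnals2021, arXiv:1912.07973 §6.1, Lemma 6.2 and its proof (p. 21); §4.2, proof of Lemma 4.4 (pp. 11–12)] -/
theorem intersectionProperty_box {β : ℝ} (hβ : 0 < β) {A c₀ C₀ : ℝ} (hC₀ : 0 < C₀)
    (hIR : ∀ x : Site 4, x ≠ 0 → twoPointFree 4 β x ≤ A / (Site.supNorm x : ℝ) ^ 2)
    {c : ℝ} (hc : 0 < c) {T : ℕ} (hT : 1 ≤ T) (hTc : 216 ^ 2 * A ^ 2 * (32 * C₀ + 64) / c ≤ T)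
    {a n₀ m₀ M₀ N₀ b : ℕ} (ha : 2 ≤ a) (hn₀ : n₀ = T * a ^ 3) (hm₀ : m₀ = T ^ 4 * a ^ 9)
    (han : a < n₀) (hnm : n₀ ≤ m₀) (hmM : m₀ ≤ M₀) (hMN : M₀ ≤ N₀) (hNb : N₀ < b)
    (h2a : 2 * a ≤ n₀) (h2n : 2 * n₀ ≤ m₀) (h2M : 2 * M₀ ≤ N₀) (h2N : 2 * N₀ ≤ b)
    (hTM : T * M₀ ^ 3 ≤ N₀) (hTN : T * N₀ ^ 3 ≤ b)
    (hΔB : 2048 * c * C₀ ^ 6 * bubbleDiagram (twoPointFree 4 β) ((2 * M₀ : ℕ) : ℝ) ≤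
      bubbleDiagram (twoPointFree 4 β) (M₀ : ℝ) - bubbleDiagram (twoPointFree 4 β) ((m₀ - 1 : ℕ) : ℝ))
    (hΔB0 : 0 < bubbleDiagram (twoPointFree 4 β) (M₀ : ℝ) - bubbleDiagram (twoPointFree 4 β) ((m₀ - 1 : ℕ) : ℝ))
    {u y : Site 4} {n : ℕ} (hreg : IsRegularScale (twoPointFree 4 β) c₀ C₀ n)
    (hn1 : (n : ℝ) ≤ dist u y) (hn2 : dist u y ≤ 2 * n) (hfar : (2 * b : ℝ) < dist u y)
    {L : ℕ} (hu : u ∈ box 4 L) (hy : y ∈ box 4 L)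
    (hfull : ∀ x : Site 4, Site.supNorm x ≤ M₀ → u + x ∈ box 4 L)
    (hguy : (1 - 1 / 2) * twoPointFree 4 β (y - u) ≤ isingTwoPoint (zdGraph 4) (box 4 L) β 0 .free u y)
    (hlow : ∀ x ∈ ann 4 m₀ M₀,
      (1 - 1 / 2) * twoPointFree 4 β (u + x - y) ≤ isingTwoPoint (zdGraph 4) (box 4 L) β 0 .free y (u + x) ∧
      (1 - 1 / 2) * twoPointFree 4 β (u + x - u) ≤ isingTwoPoint (zdGraph 4) (box 4 L) β 0 .free u (u + x)) :
    ENNReal.ofReal c * finVolFourNrm (box 4 L) β u y y ≤ finVolIkMass (box 4 L) β u y a b := by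
  -- the graph, the couplings, the ranking of the bonds, the metric hypotheses
  have hK : ∀ e : (boxGraph (box 4 L)).edgeFinset, (0 : ℝ) ≤ (fun _ => β) e := fun _ => hβ.le
  obtain ⟨rk, hrk⟩ : ∃ rk : (boxGraph (box 4 L)).edgeFinset → ℕ, Function.Injective rk :=
    ⟨fun e => (Fintype.equivFin _ e : ℕ), fun e e' h => (Fintype.equivFin _).injective (Fin.ext h)⟩
  set u' : ↥(box 4 L) := ⟨u, hu⟩ with hu'
  set y' : ↥(box 4 L) := ⟨y, hy⟩ with hy'
  have hstep : ∀ v w : ↥(box 4 L), (boxGraph (box 4 L)).Adj v w → dist u' w ≤ dist u' v + 1 :=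
    fun v w h => boxGraph_dist_step u' v w h
  have hint : ∀ v : ↥(box 4 L), ∃ k : ℕ, dist u' v = k := fun v => boxGraph_dist_natCast u' v
  have hdist : ∀ v : ↥(box 4 L), dist u' v = dist u (v : Site 4) := fun v => Subtype.dist_eq u' v
  have hb0 : (0 : ℝ) ≤ b := Nat.cast_nonneg b
  have hyfar : (b : ℝ) < dist u' y' := by rw [hdist]; change (b : ℝ) < dist u y; linarith
  -- the sets
  have hW : ∀ v : ↥(box 4 L), v ∈ latAnnulus (box 4 L) u a b ↔ (a : ℝ) ≤ dist u' v ∧ dist u' v ≤ b := by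
    intro v
    unfold latAnnulus
    rw [Finset.mem_filter, hdist]
    simp
  have hA : ∀ v ∈ latAnnulus (box 4 L) u m₀ M₀, (m₀ : ℝ) ≤ dist u' v ∧ dist u' v ≤ M₀ := by
    intro v hv
    unfold latAnnulus at hv
    rw [Finset.mem_filter] at hv
    rw [hdist]
    exact hv.2
  set Sph : ℕ → Finset ↥(box 4 L) := fun r => univ.filter fun v => dist u (v : Site 4) = r with hSph
  have hS : ∀ r : ℕ, ∀ v : ↥(box 4 L), dist u' v = r → v ∈ Sph r := by
    intro r v hv
    rw [hSph, Finset.mem_filter, ← hdist]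
    exact ⟨Finset.mem_univ _, hv⟩
  have hS' : ∀ r : ℕ, ∀ v ∈ Sph r, dist u (v : Site 4) = r := by
    intro r v hv
    rw [hSph, Finset.mem_filter] at hv
    exact hv.2
  -- the two-point functions
  set S : Site 4 → ℝ := twoPointFree 4 β with hSdef
  set g : ↥(box 4 L) → ↥(box 4 L) → ℝ := fun v w =>
    isingTwoPoint (zdGraph 4) (box 4 L) β 0 .free (v : Site 4) (w : Site 4) with hgdef
  have hS0 : ∀ x, 0 ≤ S x := fun x => twoPointFree_nonneg_of_nonneg hβ.le x
  have hgpos : ∀ v w, 0 < g v w := fun v w => isingTwoPoint_box_pos hβ v w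
  have hg0 : ∀ v w, 0 ≤ g v w := fun v w => (hgpos v w).le
  have hgS : ∀ v w : ↥(box 4 L), g v w ≤ S ((w : Site 4) - v) := fun v w =>
    isingTwoPoint_box_le_twoPointFree hβ.le v.2 w.2
  have hg : ∀ v w : ↥(box 4 L), ecurrentSum (fun _ : (boxGraph (box 4 L)).edgeFinset => β) ({v} ∆ {w}) =
      ecurrentSum (fun _ : (boxGraph (box 4 L)).edgeFinset => β) ∅ * ENNReal.ofReal (g v w) := by
    intro v w
    have h := toReal_ecurrentSum_pair_eq_mul_isingTwoPoint (box 4 L) hβ.le v w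
    rw [← ENNReal.ofReal_toReal (ecurrentSum_ne_top hK ({v} ∆ {w})), h,
      ENNReal.ofReal_mul ENNReal.toReal_nonneg, ENNReal.ofReal_toReal (ecurrentSum_ne_top hK _)]
  have hA0 : 0 ≤ A := irBound_nonneg hS0 hIR
  -- the regular annulus around `y`
  set Suy : ℝ := S (y - u) with hSuy
  have hdy : dist u y = (Site.supNorm (y - u) : ℝ) := dist_eq_supNorm_sub' u y
  have hnn1 : n ≤ Site.supNorm (y - u) := by rw [hdy] at hn1; exact_mod_cast hn1
  have hnn2 : Site.supNorm (y - u) ≤ 2 * n := by rw [hdy] at hn2; exact_mod_cast hn2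
  have hnnb : 2 * b < Site.supNorm (y - u) := by rw [hdy] at hfar; exact_mod_cast hfar
  have hRa : ∀ w : Site 4, Site.supNorm (w - u) ≤ b → S (y - w) ≤ C₀ * Suy := by
    intro w hw
    obtain ⟨hyw, -, hyu, -⟩ := mem_ann_of_central_regular hnn1 hnn2 hnnb hw
    exact hreg.p1 (y - u) hyu (y - w) hyw
  have hRb : ∀ w : Site 4, Site.supNorm (w - u) ≤ b → Suy ≤ C₀ * S (w - y) := by
    intro w hw
    obtain ⟨-, hwy, hyu, -⟩ := mem_ann_of_central_regular hnn1 hnn2 hnnb hw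
    exact hreg.p1 (w - y) hwy (y - u) hyu
  have hSuy_pos : 0 < Suy := lt_of_lt_of_le (hgpos u' y') (hgS u' y')
  have hguy' : Suy / 2 ≤ g u' y' := by
    have : (1 - 1 / 2) * Suy ≤ g u' y' := hguy
    linarith
  have hgyS : g u' y' ≤ Suy := hgS u' y'
  have hlow' : ∀ v ∈ latAnnulus (box 4 L) u m₀ M₀,
      S ((v : Site 4) - y) / 2 ≤ g y' v ∧ S ((v : Site 4) - u) / 2 ≤ g u' v := by
    intro v hv
    have hx : (v : Site 4) - u ∈ ann 4 m₀ M₀ := by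
      have h := hA v hv
      rw [hdist, dist_eq_supNorm_sub'] at h
      rw [mem_ann]
      exact ⟨by exact_mod_cast h.1, by exact_mod_cast h.2⟩
    obtain ⟨h1, h2⟩ := hlow _ hx
    rw [add_sub_cancel] at h1 h2
    change (1 - 1 / 2) * S ((v : Site 4) - y) ≤ g y' v at h1
    change (1 - 1 / 2) * S ((v : Site 4) - u) ≤ g u' v at h2
    exact ⟨by linarith, by linarith⟩
  clear_value g S Sph
  -- distances of the vertices of the annuli / spheres from `u`, as sup norms
  have hsupA : ∀ v ∈ latAnnulus (box 4 L) u m₀ M₀, Site.supNorm ((v : Site 4) - u) ≤ b := by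
    intro v hv
    have h := (hA v hv).2
    rw [hdist, dist_eq_supNorm_sub'] at h
    have : Site.supNorm ((v : Site 4) - u) ≤ M₀ := by exact_mod_cast h
    omega
  have hsupS : ∀ r : ℕ, r ≤ b → ∀ v ∈ Sph r, Site.supNorm ((v : Site 4) - u) ≤ b := by
    intro r hr v hv
    have h := hS' r v hv
    rw [dist_eq_supNorm_sub'] at h
    have : Site.supNorm ((v : Site 4) - u) = r := by exact_mod_cast h
    omega
  -- (i) the first moment: `s₁ ≥ Suy²/(16 C₀²) ΔB`
  set ΔB : ℝ := bubbleDiagram S (M₀ : ℝ) - bubbleDiagram S ((m₀ - 1 : ℕ) : ℝ) with hΔB'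
  have hm1 : 1 ≤ m₀ := by omega
  have hmM1 : m₀ ≤ M₀ + 1 := by omega
  have hannS : ∑ v ∈ latAnnulus (box 4 L) u m₀ M₀, S ((v : Site 4) - u) ^ 2 = ΔB := by
    rw [sum_latAnnulus_eq_sum_ann hfull (fun x => S x ^ 2), sum_ann_sq_eq hm1 hmM1]
  have hs₁ : Suy ^ 2 / (16 * C₀ ^ 2) * ΔB ≤
      ∑ v ∈ latAnnulus (box 4 L) u m₀ M₀, (g y' v * g u' v) ^ 2 := by
    rw [← hannS]
    exact first_moment_lower (latAnnulus (box 4 L) u m₀ M₀) (Sy := fun v => S ((v : Site 4) - y))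
      (Su := fun v => S ((v : Site 4) - u)) hC₀ hSuy_pos.le (fun v _ => hS0 _)
      (fun v hv => hRb _ (hsupA v hv)) (fun v hv => (hlow' v hv).1) (fun v hv => (hlow' v hv).2)
  -- (ii) the second moment: `t₂ ≤ C₀² Suy² · 4 ΔB B_{2M₀}`
  have hannSS : ∑ v ∈ latAnnulus (box 4 L) u m₀ M₀, ∑ w ∈ latAnnulus (box 4 L) u m₀ M₀,
      (S ((v : Site 4) - u) * S ((w : Site 4) - v) + S ((w : Site 4) - u) * S ((v : Site 4) - w)) ^ 2 ≤
      4 * ΔB * bubbleDiagram S ((2 * M₀ : ℕ) : ℝ) := by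
    have h := sum_latAnnulus_latAnnulus_eq (m := m₀) hfull (fun x z => (S x * S (z - x) + S z * S (x - z)) ^ 2)
    have h' : ∑ v ∈ latAnnulus (box 4 L) u m₀ M₀, ∑ w ∈ latAnnulus (box 4 L) u m₀ M₀,
        (S ((v : Site 4) - u) * S ((w : Site 4) - v) + S ((w : Site 4) - u) * S ((v : Site 4) - w)) ^ 2 =
        ∑ v ∈ latAnnulus (box 4 L) u m₀ M₀, ∑ w ∈ latAnnulus (box 4 L) u m₀ M₀,
          (S ((v : Site 4) - u) * S (((w : Site 4) - u) - ((v : Site 4) - u)) +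
            S ((w : Site 4) - u) * S (((v : Site 4) - u) - ((w : Site 4) - u))) ^ 2 := by
      simp only [sub_sub_sub_cancel_right]
    rw [h', h]
    exact sum_ann_ann_sq_le S hm1 hmM1
  have ht₂ : ∑ v ∈ latAnnulus (box 4 L) u m₀ M₀, ∑ w ∈ latAnnulus (box 4 L) u m₀ M₀,
      (g u' v * g v w * g w y' + g u' w * g w v * g v y') ^ 2 ≤
      C₀ ^ 2 * Suy ^ 2 * (4 * ΔB * bubbleDiagram S ((2 * M₀ : ℕ) : ℝ)) := by
    refine (second_moment_upper (latAnnulus (box 4 L) u m₀ M₀) g (fun v w => S ((w : Site 4) - v)) u' y'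
      hg0 hgS (fun v w => hS0 _) (fun w hw => hRa _ (hsupA w hw))).trans ?_
    exact mul_le_mul_of_nonneg_left hannSS (by positivity)
  -- (iii) the zigzag sums
  have ha1 : 1 ≤ a := by omega
  have hN1 : 1 ≤ N₀ := by omega
  have hn1' : 1 ≤ n₀ := by omega
  have hM1 : 1 ≤ M₀ := by omega
  have hT0 : (0 : ℝ) < T := by exact_mod_cast (show 0 < T by omega)
  have hr₁ : ∑ v ∈ Sph n₀, ∑ w ∈ Sph a, g u' v * g v w * g w y' ≤
      C₀ * Suy * (4 * 216 ^ 2 * A ^ 2 / T) := by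
    refine (zigzag_sum_upper (Sph n₀) (Sph a) g (fun v w => S ((w : Site 4) - v)) u' y' hg0 hgS
      (fun v w => hS0 _) (fun w hw => hRa _ (hsupS a (by omega) w hw))).trans ?_
    refine mul_le_mul_of_nonneg_left ?_ (by positivity)
    calc ∑ v ∈ Sph n₀, ∑ w ∈ Sph a, S ((v : Site 4) - u') * S ((w : Site 4) - v)
        = ∑ v ∈ Sph n₀, ∑ w ∈ Sph a, S ((v : Site 4) - u) * S (((w : Site 4) - u) - ((v : Site 4) - u)) := by
          simp only [sub_sub_sub_cancel_right]; rfl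
      _ ≤ ∑ x ∈ sphere 4 n₀, ∑ z ∈ sphere 4 a, S x * S (z - x) :=
          sum_distSphere_sphere_le u n₀ a (fun x z => S x * S (z - x)) (fun x z => mul_nonneg (hS0 _) (hS0 _))
            (Sph n₀) (Sph a) (hS' n₀) (hS' a)
      _ ≤ 4 * 216 ^ 2 * A ^ 2 * (a : ℝ) ^ 3 / n₀ := sum_sphere_sphere_mul_le hS0 hIR ha1 h2a
      _ = 4 * 216 ^ 2 * A ^ 2 / T := by
          rw [hn₀]; push_cast
          have ha0 : (0 : ℝ) < a := by exact_mod_cast (show 0 < a by omega)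
          field_simp
  have hr₄ : ∑ v ∈ Sph b, ∑ w ∈ Sph N₀, g u' v * g v w * g w y' ≤
      C₀ * Suy * (4 * 216 ^ 2 * A ^ 2 / T) := by
    refine (zigzag_sum_upper (Sph b) (Sph N₀) g (fun v w => S ((w : Site 4) - v)) u' y' hg0 hgS
      (fun v w => hS0 _) (fun w hw => hRa _ (hsupS N₀ hNb.le w hw))).trans ?_
    refine mul_le_mul_of_nonneg_left ?_ (by positivity)
    calc ∑ v ∈ Sph b, ∑ w ∈ Sph N₀, S ((v : Site 4) - u') * S ((w : Site 4) - v)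
        = ∑ v ∈ Sph b, ∑ w ∈ Sph N₀, S ((v : Site 4) - u) * S (((w : Site 4) - u) - ((v : Site 4) - u)) := by
          simp only [sub_sub_sub_cancel_right]; rfl
      _ ≤ ∑ x ∈ sphere 4 b, ∑ z ∈ sphere 4 N₀, S x * S (z - x) :=
          sum_distSphere_sphere_le u b N₀ (fun x z => S x * S (z - x)) (fun x z => mul_nonneg (hS0 _) (hS0 _))
            (Sph b) (Sph N₀) (hS' b) (hS' N₀)
      _ ≤ 4 * 216 ^ 2 * A ^ 2 * (N₀ : ℝ) ^ 3 / b := sum_sphere_sphere_mul_le hS0 hIR hN1 h2N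
      _ ≤ 4 * 216 ^ 2 * A ^ 2 / T := by
          have hb0 : (0 : ℝ) < b := by exact_mod_cast (show 0 < b by omega)
          have hTN' : (T : ℝ) * (N₀ : ℝ) ^ 3 ≤ b := by exact_mod_cast hTN
          rw [div_le_div_iff₀ hb0 hT0]
          nlinarith [sq_nonneg A]
  -- (iv) the band sums
  have hr₂ : ∑ v ∈ Sph n₀, ∑ w ∈ Sph m₀, g v w ^ 2 ≤ 16 * 216 ^ 2 * A ^ 2 / T := by
    refine (band_sum_upper (Sph n₀) (Sph m₀) g (fun v w => S ((w : Site 4) - v)) hg0 hgS).trans ?_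
    calc ∑ v ∈ Sph n₀, ∑ w ∈ Sph m₀, S ((w : Site 4) - v) ^ 2
        = ∑ v ∈ Sph n₀, ∑ w ∈ Sph m₀, S (((w : Site 4) - u) - ((v : Site 4) - u)) ^ 2 := by
          simp only [sub_sub_sub_cancel_right]
      _ ≤ ∑ x ∈ sphere 4 n₀, ∑ z ∈ sphere 4 m₀, S (z - x) ^ 2 :=
          sum_distSphere_sphere_le u n₀ m₀ (fun x z => S (z - x) ^ 2) (fun x z => sq_nonneg _)
            (Sph n₀) (Sph m₀) (hS' n₀) (hS' m₀)
      _ ≤ 16 * 216 ^ 2 * A ^ 2 * (n₀ : ℝ) ^ 3 / m₀ := sum_sphere_sphere_sq_le_of_two_mul_le hS0 hIR hn1' h2n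
      _ = 16 * 216 ^ 2 * A ^ 2 / T := by
          rw [hm₀, hn₀]; push_cast
          have ha0 : (0 : ℝ) < a := by exact_mod_cast (show 0 < a by omega)
          field_simp
  have hr₃ : ∑ v ∈ Sph M₀, ∑ w ∈ Sph N₀, g v w ^ 2 ≤ 16 * 216 ^ 2 * A ^ 2 / T := by
    refine (band_sum_upper (Sph M₀) (Sph N₀) g (fun v w => S ((w : Site 4) - v)) hg0 hgS).trans ?_
    calc ∑ v ∈ Sph M₀, ∑ w ∈ Sph N₀, S ((w : Site 4) - v) ^ 2
        = ∑ v ∈ Sph M₀, ∑ w ∈ Sph N₀, S (((w : Site 4) - u) - ((v : Site 4) - u)) ^ 2 := by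
          simp only [sub_sub_sub_cancel_right]
      _ ≤ ∑ x ∈ sphere 4 M₀, ∑ z ∈ sphere 4 N₀, S (z - x) ^ 2 :=
          sum_distSphere_sphere_le u M₀ N₀ (fun x z => S (z - x) ^ 2) (fun x z => sq_nonneg _)
            (Sph M₀) (Sph N₀) (hS' M₀) (hS' N₀)
      _ ≤ 16 * 216 ^ 2 * A ^ 2 * (M₀ : ℝ) ^ 3 / N₀ := sum_sphere_sphere_sq_le_of_two_mul_le hS0 hIR hM1 h2M
      _ ≤ 16 * 216 ^ 2 * A ^ 2 / T := by
          have hN0 : (0 : ℝ) < N₀ := by exact_mod_cast (show 0 < N₀ by omega)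
          have hTM' : (T : ℝ) * (M₀ : ℝ) ^ 3 ≤ N₀ := by exact_mod_cast hTM
          rw [div_le_div_iff₀ hN0 hT0]
          nlinarith [sq_nonneg A]
  -- the three hypotheses of the finite-graph assembly
  have h0 : 0 < ∑ v ∈ latAnnulus (box 4 L) u m₀ M₀, (g y' v * g u' v) ^ 2 :=
    lt_of_lt_of_le (by positivity) hs₁
  have h1 : 2 * c * (g u' y' ^ 2 * ∑ v ∈ latAnnulus (box 4 L) u m₀ M₀, ∑ w ∈ latAnnulus (box 4 L) u m₀ M₀,
      (g u' v * g v w * g w y' + g u' w * g w v * g v y') ^ 2) ≤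
      (∑ v ∈ latAnnulus (box 4 L) u m₀ M₀, (g y' v * g u' v) ^ 2) ^ 2 := by
    have hB2 : 0 ≤ bubbleDiagram S ((2 * M₀ : ℕ) : ℝ) := bubbleDiagram_nonneg _ _
    have hlhs : 2 * c * (g u' y' ^ 2 * ∑ v ∈ latAnnulus (box 4 L) u m₀ M₀, ∑ w ∈ latAnnulus (box 4 L) u m₀ M₀,
        (g u' v * g v w * g w y' + g u' w * g w v * g v y') ^ 2) ≤
        2 * c * (Suy ^ 2 * (C₀ ^ 2 * Suy ^ 2 * (4 * ΔB * bubbleDiagram S ((2 * M₀ : ℕ) : ℝ)))) := by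
      refine mul_le_mul_of_nonneg_left (mul_le_mul (pow_le_pow_left₀ (hg0 _ _) hgyS 2) ht₂
        (Finset.sum_nonneg fun v _ => Finset.sum_nonneg fun w _ => sq_nonneg _) (sq_nonneg _)) (by positivity)
    have hrhs : (Suy ^ 2 / (16 * C₀ ^ 2) * ΔB) ^ 2 ≤ (∑ v ∈ latAnnulus (box 4 L) u m₀ M₀, (g y' v * g u' v) ^ 2) ^ 2 :=
      pow_le_pow_left₀ (by positivity) hs₁ 2
    refine le_trans hlhs (le_trans ?_ hrhs)
    -- `8 c C₀² Suy⁴ ΔB B₂ ≤ Suy⁴ ΔB²/(256 C₀⁴)` from `2048 c C₀⁶ B₂ ≤ ΔB`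
    have key : 2 * c * (C₀ ^ 2 * (4 * bubbleDiagram S ((2 * M₀ : ℕ) : ℝ))) ≤ ΔB / (256 * C₀ ^ 4) := by
      rw [le_div_iff₀ (by positivity)]
      nlinarith
    calc 2 * c * (Suy ^ 2 * (C₀ ^ 2 * Suy ^ 2 * (4 * ΔB * bubbleDiagram S ((2 * M₀ : ℕ) : ℝ))))
        = (Suy ^ 4 * ΔB) * (2 * c * (C₀ ^ 2 * (4 * bubbleDiagram S ((2 * M₀ : ℕ) : ℝ)))) := by ring
      _ ≤ (Suy ^ 4 * ΔB) * (ΔB / (256 * C₀ ^ 4)) := mul_le_mul_of_nonneg_left key (by positivity)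
      _ = (Suy ^ 2 / (16 * C₀ ^ 2) * ΔB) ^ 2 := by field_simp; ring
  have h2 : 2 * ((∑ v ∈ Sph n₀, ∑ w ∈ Sph a, g u' v * g v w * g w y' +
      ∑ v ∈ Sph b, ∑ w ∈ Sph N₀, g u' v * g v w * g w y') +
      g u' y' * (∑ v ∈ Sph n₀, ∑ w ∈ Sph m₀, g v w ^ 2 + ∑ v ∈ Sph M₀, ∑ w ∈ Sph N₀, g v w ^ 2)) ≤
      c * g u' y' := by
    have hK' : (0 : ℝ) ≤ 216 ^ 2 * A ^ 2 := by positivity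
    calc 2 * ((∑ v ∈ Sph n₀, ∑ w ∈ Sph a, g u' v * g v w * g w y' +
          ∑ v ∈ Sph b, ∑ w ∈ Sph N₀, g u' v * g v w * g w y') +
          g u' y' * (∑ v ∈ Sph n₀, ∑ w ∈ Sph m₀, g v w ^ 2 + ∑ v ∈ Sph M₀, ∑ w ∈ Sph N₀, g v w ^ 2))
        ≤ 2 * ((C₀ * Suy * (4 * 216 ^ 2 * A ^ 2 / T) + C₀ * Suy * (4 * 216 ^ 2 * A ^ 2 / T)) +
          g u' y' * (16 * 216 ^ 2 * A ^ 2 / T + 16 * 216 ^ 2 * A ^ 2 / T)) :=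
          mul_le_mul_of_nonneg_left (add_le_add (add_le_add hr₁ hr₄)
            (mul_le_mul_of_nonneg_left (add_le_add hr₂ hr₃) (hg0 _ _))) zero_le_two
      _ = (216 ^ 2 * A ^ 2 / T) * (16 * C₀ * Suy + 64 * g u' y') := by ring
      _ ≤ (216 ^ 2 * A ^ 2 / T) * ((32 * C₀ + 64) * g u' y') := by
          refine mul_le_mul_of_nonneg_left ?_ (by positivity)
          nlinarith [hguy', hC₀.le, hg0 u' y']
      _ = (216 ^ 2 * A ^ 2 * (32 * C₀ + 64)) / T * g u' y' := by ring
      _ ≤ c * g u' y' := by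
          refine mul_le_mul_of_nonneg_right ?_ (hg0 _ _)
          rw [div_le_iff₀ hT0]
          have h := (div_le_iff₀ hc).1 hTc
          linarith
  -- the finite-graph assembly
  have key := Current.ikMass_lower_bound_of_twoPoint hK hrk hstep hint han hnm hmM hMN hNb hyfar hW hA
    (hS a) (hS n₀) (hS m₀) (hS M₀) (hS N₀) (hS b) hg0 hg hc.le h0 h1 h2
  -- back to the finite-volume dictionary
  rw [finVolFourNrm_eq β hu hy hy]
  unfold finVolIkMass
  rw [dif_pos ⟨hu, hy⟩]
  exact key


/-! ### Part E. Lemma 6.2 in finite volume: the hypothesis `Hint` of the clustering bound -/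

/-- **Aizenman–Duminil-Copin 2021, Lemma 6.2 (intersection property), finite-volume form on `ℤ⁴`** —
exactly the hypothesis `Hint` of `improvedTreeDiagramBound_of_intersection_and_mixing`: for
regularity constants `c₀, C₀ > 0` there are `α₀, D₁` and `c_I > 0` such that for `0 < β ≤ β_c`,
scales `2 ≤ a`, `a^{α₀} ≤ b` with `b` in the window `b ≤ ξ(β)` and `D₁ B_a(β) ≤ B_b(β)` (the dynamic
scales `a = ℓ_k`, `b = ℓ_{k+1}` of §6.1 with `D` large, Lemma 6.3), every centre `u` and far vertex `y`
central in a `(c₀,C₀)`-regular scale `n` (`n ≤ ‖y-u‖ ≤ 2n`, Thm 5.12) with `‖y-u‖ > 2b`, eventually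
in `L`, `c_I · finVolFourNrm (box 4 L) β u y y ≤ finVolIkMass (box 4 L) β u y a b`, i.e.
"`P^{0y,0y,∅,∅}_β[I_k] ≥ c`" for the finite-volume four currents on `Λ_L`. Constants: with the
infrared constant `A` and the constant `C` of Lemma 6.3, `Γ = 1 + 11C`, `c_I = 1/(4096 Γ C₀⁶)`,
`T = ⌈216²A²(32C₀+64)/c_I⌉ + 1`, `α₀ = 81 + 40T`, `D₁ = 2Γ(1 + C(4 log T/log 2 + 10))`.
[cite: AizenmanDuminilCopinAnnals2021, arXiv:1912.07973 §6.1, Lemma 6.2 and its proof (p. 21); §4.2, Lemma 4.4 and its proof (pp. 11–12)] -/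
theorem intersectionProperty_Hint :
    ∀ c₀ C₀ : ℝ, 0 < c₀ → 0 < C₀ → ∃ α₀ D₁ cI : ℝ, 0 < cI ∧
      ∀ β : ℝ, 0 < β → β ≤ criticalBeta 4 → ∀ a b : ℕ, 2 ≤ a → (a : ℝ) ^ α₀ ≤ b →
        (β = criticalBeta 4 ∨ (0 < β ∧ (b : ℝ) * invCorrLength (twoPointPlus 4 β) ≤ 1)) →
        D₁ * bubbleDiagram (twoPointFree 4 β) a ≤ bubbleDiagram (twoPointFree 4 β) b →
        ∀ u y : Site 4, (∃ n : ℕ, IsRegularScale (twoPointFree 4 β) c₀ C₀ n ∧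
            (n : ℝ) ≤ dist u y ∧ dist u y ≤ 2 * n) → (2 * b : ℝ) < dist u y →
        ∀ᶠ L : ℕ in atTop,
          ENNReal.ofReal cI * finVolFourNrm (box 4 L) β u y y ≤ finVolIkMass (box 4 L) β u y a b := by
  intro c₀ C₀ _hc₀ hC₀
  obtain ⟨A, hA0, hIR⟩ := exists_infraredBound_twoPointFree_four
  obtain ⟨C, hC, hgrowth⟩ := bubbleDiagram_growth_twoPointFree
  -- the constants
  obtain ⟨Γ, hΓ⟩ : ∃ Γ : ℝ, Γ = 1 + 11 * C := ⟨_, rfl⟩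
  have hΓpos : 0 < Γ := by rw [hΓ]; positivity
  obtain ⟨c, hc⟩ : ∃ c : ℝ, c = 1 / (4096 * Γ * C₀ ^ 6) := ⟨_, rfl⟩
  have hcpos : 0 < c := by rw [hc]; positivity
  obtain ⟨T, hT⟩ : ∃ T : ℕ, T = ⌈216 ^ 2 * A ^ 2 * (32 * C₀ + 64) / c⌉₊ + 1 := ⟨_, rfl⟩
  have hT1 : 1 ≤ T := by rw [hT]; omega
  have hTc : 216 ^ 2 * A ^ 2 * (32 * C₀ + 64) / c ≤ T := by
    rw [hT]; push_cast
    exact (Nat.le_ceil _).trans (by linarith)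
  obtain ⟨ΓT, hΓT⟩ : ∃ ΓT : ℝ, ΓT = 1 + C * (4 * Real.log T / Real.log 2 + 10) := ⟨_, rfl⟩
  have hΓTpos : 0 < ΓT := by
    rw [hΓT]
    have : 0 ≤ Real.log T := Real.log_nonneg (by exact_mod_cast hT1)
    have : 0 < Real.log 2 := Real.log_pos one_lt_two
    positivity
  refine ⟨((81 + 40 * T : ℕ) : ℝ), 2 * Γ * ΓT, c, hcpos, ?_⟩
  intro β hβ hβc a b ha hab hwin hD u y hyreg hfar
  obtain ⟨n, hreg, hn1, hn2⟩ := hyreg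
  -- the intermediary scales `a < n₀ ≤ m₀ ≤ M₀ ≤ N₀ < b`
  obtain ⟨n₀, m₀, M₀, N₀, hn₀, hm₀, han, hnm, hmM, hMN, hNb, h2a, h2n, h2M, h2N, hTM, hTN, hbM, h512⟩ :=
    exists_intermediaryScales hT1 ha (scales_hyp_of_rpow_le ha hab)
  -- the bubble diagrams: `B_{M₀} - B_{m₀-1} ≥ B_b/(2Γ) ≥ 2048 c C₀⁶ B_{2M₀}`
  have hgrowthβ : ∀ ℓ L : ℕ, 2 ≤ ℓ → ℓ ≤ L →
      (β = criticalBeta 4 ∨ (0 < β ∧ (L : ℝ) * invCorrLength (twoPointPlus 4 β) ≤ 1)) →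
      bubbleDiagram (twoPointFree 4 β) L ≤
        (1 + C * (1 + Real.log ((L : ℝ) / ℓ)) / Real.log ℓ) * bubbleDiagram (twoPointFree 4 β) ℓ :=
    fun ℓ L h1 h2 h3 => hgrowth β ℓ L hβ.le hβc h1 h2 h3
  have hT4 : 1 ≤ T ^ 4 := Nat.one_le_pow _ _ hT1
  have hM512 : 512 ≤ M₀ := le_trans (by nlinarith) h512
  have hBb : bubbleDiagram (twoPointFree 4 β) b ≤ Γ * bubbleDiagram (twoPointFree 4 β) M₀ := by
    rw [hΓ]; exact bubble_upper_of_growth hC hgrowthβ hM512 (by omega) hbM hwin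
  have hwin' : β = criticalBeta 4 ∨ (0 < β ∧ ((m₀ - 1 : ℕ) : ℝ) * invCorrLength (twoPointPlus 4 β) ≤ 1) :=
    adcWindow_mono hβ.le hwin (by exact_mod_cast (show m₀ - 1 ≤ b by omega))
  have hBm : bubbleDiagram (twoPointFree 4 β) ((m₀ - 1 : ℕ) : ℝ) ≤ ΓT * bubbleDiagram (twoPointFree 4 β) a := by
    rw [hΓT]; exact bubble_lower_of_growth hC hgrowthβ hT1 ha hm₀ (by omega) hwin'
  have hB2M : bubbleDiagram (twoPointFree 4 β) ((2 * M₀ : ℕ) : ℝ) ≤ bubbleDiagram (twoPointFree 4 β) b :=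
    bubbleDiagram_mono _ (by exact_mod_cast (show 2 * M₀ ≤ b by omega))
  have hBb1 : 1 ≤ bubbleDiagram (twoPointFree 4 β) b :=
    one_le_bubbleDiagram (twoPointFree_zero 4 β) (Nat.cast_nonneg b)
  have hΔ : bubbleDiagram (twoPointFree 4 β) b / (2 * Γ) ≤
      bubbleDiagram (twoPointFree 4 β) (M₀ : ℝ) - bubbleDiagram (twoPointFree 4 β) ((m₀ - 1 : ℕ) : ℝ) := by
    have h1 : bubbleDiagram (twoPointFree 4 β) b / Γ ≤ bubbleDiagram (twoPointFree 4 β) M₀ := by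
      rw [div_le_iff₀ hΓpos]; linarith
    have h2 : bubbleDiagram (twoPointFree 4 β) ((m₀ - 1 : ℕ) : ℝ) ≤ bubbleDiagram (twoPointFree 4 β) b / (2 * Γ) :=
      calc bubbleDiagram (twoPointFree 4 β) ((m₀ - 1 : ℕ) : ℝ) ≤ ΓT * bubbleDiagram (twoPointFree 4 β) a := hBm
        _ ≤ ΓT * (bubbleDiagram (twoPointFree 4 β) b / (2 * Γ * ΓT)) := by
            refine mul_le_mul_of_nonneg_left ?_ hΓTpos.le
            rw [le_div_iff₀ (by positivity)]
            linarith
        _ = bubbleDiagram (twoPointFree 4 β) b / (2 * Γ) := by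
            field_simp
    have h3 : bubbleDiagram (twoPointFree 4 β) b / Γ =
        bubbleDiagram (twoPointFree 4 β) b / (2 * Γ) + bubbleDiagram (twoPointFree 4 β) b / (2 * Γ) := by
      field_simp; ring
    linarith
  have hΔB : 2048 * c * C₀ ^ 6 * bubbleDiagram (twoPointFree 4 β) ((2 * M₀ : ℕ) : ℝ) ≤
      bubbleDiagram (twoPointFree 4 β) (M₀ : ℝ) - bubbleDiagram (twoPointFree 4 β) ((m₀ - 1 : ℕ) : ℝ) :=
    calc 2048 * c * C₀ ^ 6 * bubbleDiagram (twoPointFree 4 β) ((2 * M₀ : ℕ) : ℝ)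
        = bubbleDiagram (twoPointFree 4 β) ((2 * M₀ : ℕ) : ℝ) / (2 * Γ) := by
          rw [hc]; field_simp; ring
      _ ≤ bubbleDiagram (twoPointFree 4 β) b / (2 * Γ) := div_le_div_of_nonneg_right hB2M (by positivity)
      _ ≤ _ := hΔ
  have hΔB0 : 0 < bubbleDiagram (twoPointFree 4 β) (M₀ : ℝ) - bubbleDiagram (twoPointFree 4 β) ((m₀ - 1 : ℕ) : ℝ) :=
    lt_of_lt_of_le (by positivity) hΔ
  -- the eventual statements about the boxes `Λ_L`
  obtain ⟨P, hP⟩ : ∃ P : Finset (Site 4 × Site 4), P = insert (u, y)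
      (((ann 4 m₀ M₀).image fun x => (y, u + x)) ∪ ((ann 4 m₀ M₀).image fun x => (u, u + x))) := ⟨_, rfl⟩
  have hPev := eventually_box_twoPoint_approx (d := 4) hβ.le P (η := 1 / 2) (by norm_num)
  have hfullev : ∀ᶠ L : ℕ in atTop, ∀ x : Site 4, Site.supNorm x ≤ M₀ → u + x ∈ box 4 L := by
    filter_upwards [eventually_ge_atTop (Site.supNorm u + M₀)] with L hL x hx
    rw [mem_box_iff_supNorm_le]
    exact (Site.supNorm_add_le u x).trans (by omega)
  filter_upwards [hPev, hfullev] with L hPL hfull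
  obtain ⟨hu, hy, hguy, -⟩ := hPL (u, y) (by rw [hP]; exact mem_insert_self _ _)
  have hlow : ∀ x ∈ ann 4 m₀ M₀,
      (1 - 1 / 2) * twoPointFree 4 β (u + x - y) ≤ isingTwoPoint (zdGraph 4) (box 4 L) β 0 .free y (u + x) ∧
      (1 - 1 / 2) * twoPointFree 4 β (u + x - u) ≤ isingTwoPoint (zdGraph 4) (box 4 L) β 0 .free u (u + x) := by
    intro x hx
    have h1 := hPL (y, u + x)
      (by rw [hP]; exact mem_insert_of_mem (mem_union_left _ (mem_image_of_mem _ hx)))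
    have h2 := hPL (u, u + x)
      (by rw [hP]; exact mem_insert_of_mem (mem_union_right _ (mem_image_of_mem _ hx)))
    exact ⟨h1.2.2.1, h2.2.2.1⟩
  exact intersectionProperty_box hβ hC₀ (fun x hx => hIR β hβ.le hβc x hx) hcpos hT1 hTc ha hn₀ hm₀ han hnm hmM
    hMN hNb h2a h2n h2M h2N hTM hTN hΔB hΔB0 hreg hn1 hn2 hfar hu hy hfull hguy hlow

end Literature.Probability.LatticeModels
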